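import Summits.BirchSwinnertonDyer.BirchSwinnertonDyer.Theorems.Rank2Observatory2DescKillSig8Core
import HarnessLib

/-!
# KERNEL-2DESC — the 2-ADIC SIGNATURE kill certificate `sig8Check`: the certificate and its soundness (PART 2 of 2)
# (rank-2 observatory, cert-1 gen 39; design `generics/sig8/README-SIG8.md`, census `census/sig2split/SIG2-CENSUS.md`)

HONEST FRAMING: per-curve certified theorems and census instruments; no claim on BSD in rank ≥ 2.
PARTITION: none — rank ≥ 2 data (N3); no r ≤ 1 cell claimed.

PART 1 (`Rank2Observatory2DescKillSig8Core`) holds the core lemma at 2, the graded outside mismatch, the binary disc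
walk and the RATIONAL-like patterns with their soundness lemmas; this file assembles them exactly as the landed
`Rank2Observatory2DescKillSig3` assembles `sig3Check`:

* `sig8Check a b c z t₁ t₂ N ε₁ ε₂ ε₃ : Bool` — root tests (`g(εᵢ) ≡ 0 (mod 2^N)`, odd unit parts), odd unit parts of
  the root differences (`D = Σ v₂(εᵢ − εⱼ)`), `notRat8`, and `walk8` from `(0, 0)` with guard `B = S + 2D`;
* a zero `(r₀, r₁, r₂, n)` of `killQ` gives `2^N ∣ Zᵢ·Rᵢ² − (w₀ − n²·eᵢ)` at the three roots (`root_rel`); if `2 ∤ n`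
  the walk refutes `y = w₀/n²` (`kill_of_walk8`); if `2 ∣ n`, the index lemma gives a root with `2^(D+1) ∤ R₀`, hence
  `w₀ − n²e₀ = 2^μ·P'` with `P'` odd, `μ ≤ S + 2D` (`val_bound`), and (`caseB8`) either `n = 0` or `v₂(n²) = 2τ > μ`
  — then every root carries the RATIONAL-like pattern `(g, P)` with `g = 2τ − μ` (resp. a diagonal one), excluded by
  `notRat8` (`ratLike_elim`, using `n'² ≡ 1 (mod 8)`) — or `2τ ≤ μ` and the walk runs with the even offset `2τ`;
* `sig8Check_sound` has the signature of `killCheck_sound` at the prime `2`, and `killValidAt_of_sig8Check` drops into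
  `killListCheckV` / `admKillsV_sound` exactly like `killValidAt_of_sig3Check`: a row's kill term is
  `killValidAt_of_sig8Check (N := …) (ε₁ := …) (ε₂ := …) (ε₃ := …) (by decide +kernel)`.

Cost: `≤ 57` walk nodes and `N ≤ 96` on every exact 2-adic kill of both censuses (13 426 classes), i.e. a few hundred
`Int` operations on numbers `< 2^(2N)`.  Sorry-free; no `native_decide`.
[cite: Cassels1991LecturesEllipticCurves, §15] [cite: CremonaAlgorithms1997, §3.6]
-/

-- single-conjunct summit: `Summit.BirchSwinnertonDyer.BirchSwinnertonDyer.…` repeats the name by design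
set_option linter.dupNamespace false

namespace Summit.BirchSwinnertonDyer.BirchSwinnertonDyer.Rank2Observatory.TwoDescKill

/-- **The 2-adic signature kill certificate** for the class `z` (`θ`-coordinates `t₁, t₂`), field cubic
`X³ + aX² + bX + c` with approximate roots `ε₁, ε₂, ε₃` mod `2^N`: root tests, odd unit parts of the root
differences, not RATIONAL-like (16 patterns), and the binary disc walk from `(0, 0)` with guard `B = S + 2D`.
[cite: CremonaAlgorithms1997, §3.6] -/
def sig8Check (a b c : ℤ) (z : ℤ × ℤ × ℤ) (t₁ t₂ : ℤ) (N : ℕ) (ε₁ ε₂ ε₃ : ℤ) : Bool :=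
  let ρ₁ := rootData 2 N z t₁ t₂ ε₁
  let ρ₂ := rootData 2 N z t₁ t₂ ε₂
  let ρ₃ := rootData 2 N z t₁ t₂ ε₃
  let D := (splitPow 2 N (ε₁ - ε₂)).1 + (splitPow 2 N (ε₁ - ε₃)).1 + (splitPow 2 N (ε₂ - ε₃)).1
  let S := max ρ₁.2.1 (max ρ₂.2.1 ρ₃.2.1)
  rootOK 2 N a b c ε₁ ρ₁ && rootOK 2 N a b c ε₂ ρ₂ && rootOK 2 N a b c ε₃ ρ₃ &&
    unitOK 2 (splitPow 2 N (ε₁ - ε₂)).2 && unitOK 2 (splitPow 2 N (ε₁ - ε₃)).2 &&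
    unitOK 2 (splitPow 2 N (ε₂ - ε₃)).2 &&
    notRat8 [ρ₁, ρ₂, ρ₃] && walk8 [ρ₁, ρ₂, ρ₃] (S + 2 * D) N N 0 0

/-! ### From the root relations to the walk -/

/-- **From the root relations to the walk**: if `2 ∤ n'` and every root satisfies
`2^N ∣ 2^s·u·R² − 2^K·(y₀ − n'²·e)` (`K` even, `K ≤ B`), a certified walk from `(0, 0)` is contradictory
(take `y = y₀ / n'²` mod `2^N`). [cite: CremonaAlgorithms1997, §3.6] -/
theorem kill_of_walk8 {L : List (ℤ × ℕ × ℤ)} {B N f K : ℕ} (hK : K ≤ B)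
    (hK2 : K % 2 = 0) (hwalk : walk8 L B N f 0 0 = true) (hLu : ∀ ρ ∈ L, ¬ (2 : ℤ) ∣ ρ.2.2)
    {y₀ n' : ℤ} (hnd : ¬ (2 : ℤ) ∣ n')
    (hrels : ∀ ρ ∈ L, ∃ R : ℤ,
      (2 : ℤ) ^ N ∣ (2 : ℤ) ^ ρ.2.1 * ρ.2.2 * R ^ 2 - (2 : ℤ) ^ K * (y₀ - n' ^ 2 * ρ.1)) : False := by
  have hpZ : Prime (2 : ℤ) := Int.prime_two
  have hcop : IsCoprime n' ((2 : ℤ) ^ N) := ((Prime.coprime_iff_not_dvd hpZ).mpr hnd).symm.pow_right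
  obtain ⟨m, k, hmk⟩ := hcop
  refine walk8_sound hLu hK hK2 f 0 0 hwalk (y₀ * m ^ 2) (by simp) ?_
  intro ρ hρ
  obtain ⟨R, t, ht⟩ := hrels ρ hρ
  exact ⟨R * m, m ^ 2 * t + (2 : ℤ) ^ K * ρ.1 * k * (1 + m * n'), by
    linear_combination m ^ 2 * ht - (2 : ℤ) ^ K * ρ.1 * (1 + m * n') * hmk⟩

/-- **RATIONAL-like roots are excluded**: if every root has `s ≡ g (mod 2)` and `u ≡ Q − 2^g·e (mod 8)` for some
`g ≥ 1` and odd `Q`, then one of the 16 patterns of `notRat8` is matched (`g ≥ 5` reduces to `3` or `4`, `Q` to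
`Q mod 8`). [folklore] -/
theorem ratLike_elim {L : List (ℤ × ℕ × ℤ)} (hrat : notRat8 L = true) {g : ℕ} (hg : 1 ≤ g) {Q : ℤ}
    (hQ : ¬ (2 : ℤ) ∣ Q)
    (hall : ∀ ρ ∈ L, ρ.2.1 % 2 = g % 2 ∧ ρ.2.2 % 8 = (Q - (2 : ℤ) ^ g * ρ.1) % 8) : False := by
  have hQ1 : Q % 2 = 1 := Int.two_dvd_ne_zero.mp hQ
  have hQ8 : Q % 8 = 1 ∨ Q % 8 = 3 ∨ Q % 8 = 5 ∨ Q % 8 = 7 := by omega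
  have hPmem : Q % 8 ∈ ([1, 3, 5, 7] : List ℤ) := by
    rcases hQ8 with h | h | h | h <;> simp [h]
  -- reduce `Q` to `Q % 8` inside the pattern
  have redQ : ∀ X : ℤ, (Q - X) % 8 = (Q % 8 - X) % 8 := fun X => ((Int.mod_modEq Q 8).sub_right X).symm
  by_cases hg4 : g ≤ 4
  · have hmem : g ∈ ([1, 2, 3, 4] : List ℕ) := by
      interval_cases g <;> simp
    refine notRat8_spec hrat hmem hPmem ?_
    intro ρ hρ
    refine ⟨(hall ρ hρ).1, ?_⟩
    rw [(hall ρ hρ).2, redQ]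
  · -- `g ≥ 5`: `2^g·e ≡ 0 ≡ 2^{g*}·e (mod 8)` for `g* ∈ {3, 4}` of the same parity
    push Not at hg4
    have kill8 : ∀ (h : ℕ), 3 ≤ h → ∀ e : ℤ, (Q - (2 : ℤ) ^ h * e) % 8 = Q % 8 := by
      intro h hh e
      obtain ⟨k, hk⟩ : ∃ k, h = 3 + k := ⟨h - 3, by omega⟩
      have e1 : Q - (2 : ℤ) ^ h * e = Q + 8 * (-((2 : ℤ) ^ k * e)) := by rw [hk, pow_add]; ring
      rw [e1, Int.add_mul_emod_self_left]
    obtain hpar | hpar : g % 2 = 1 ∨ g % 2 = 0 := by omega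
    · refine notRat8_spec hrat (g := 3) (by simp) hPmem ?_
      intro ρ hρ
      refine ⟨by have := (hall ρ hρ).1; omega, ?_⟩
      rw [(hall ρ hρ).2, kill8 g (by omega), ← redQ, kill8 3 le_rfl]
    · refine notRat8_spec hrat (g := 4) (by simp) hPmem ?_
      intro ρ hρ
      refine ⟨by have := (hall ρ hρ).1; omega, ?_⟩
      rw [(hall ρ hρ).2, kill8 g (by omega), ← redQ, kill8 4 (by omega)]

/-- **Case `2 ∣ n`.** With a root `ρ₀` whose value `R₀` has `2^(D+1) ∤ R₀` (`w₀ − n²e₀ = 2^μ·P'`, `P'` odd,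
`μ ≤ S + 2D`): `n = 0` or `v₂(n²) = 2τ > μ` makes every root RATIONAL-like (pattern `g = 2τ − μ`,
`Q = P' + 2^g·n'²·e₀`, using `n'² ≡ 1 (mod 8)`; diagonal for `n = 0`), excluded by `notRat8`; otherwise `2τ ≤ μ` and
the walk runs with the even offset `2τ`. [cite: CremonaAlgorithms1997, §3.6] -/
theorem caseB8 {L : List (ℤ × ℕ × ℤ)} {S D N f : ℕ} {w₀ n : ℤ}
    (hwalk : walk8 L (S + 2 * D) N f 0 0 = true)
    (hL : ∀ ρ ∈ L, ¬ (2 : ℤ) ∣ ρ.2.2 ∧ ρ.2.1 ≤ S ∧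
      ∃ R : ℤ, (2 : ℤ) ^ N ∣ (2 : ℤ) ^ ρ.2.1 * ρ.2.2 * R ^ 2 - (w₀ - n ^ 2 * ρ.1))
    (hrat : notRat8 L = true)
    {ρ₀ : ℤ × ℕ × ℤ} (hρ₀ : ρ₀ ∈ L) {R₀ : ℤ} (hR₀ : ¬ (2 : ℤ) ^ (D + 1) ∣ R₀)
    (hrel₀ : (2 : ℤ) ^ N ∣ (2 : ℤ) ^ ρ₀.2.1 * ρ₀.2.2 * R₀ ^ 2 - (w₀ - n ^ 2 * ρ₀.1)) : False := by
  have hpZ : Prime (2 : ℤ) := Int.prime_two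
  have hq0 : (2 : ℤ) ≠ 0 := by norm_num
  have hguard : 0 + (S + 2 * D) + 2 < N := walk8_guard hwalk
  obtain ⟨hu₀, hs₀, -⟩ := hL ρ₀ hρ₀
  obtain ⟨μ, P', hP, hP', hμ⟩ := val_bound Nat.prime_two hu₀ hR₀ (by omega : ρ₀.2.1 + 2 * D < N) hrel₀
  simp only [Nat.cast_ofNat] at hP hP'
  have hμN : μ + 2 < N := by omega
  -- every root: `2^N ∣ 2^s·u·R² − 2^μ·W` with `W = P' + M·(e₀ − e)` whenever `n² = 2^μ·M`
  have sig : ∀ M : ℤ, n ^ 2 = (2 : ℤ) ^ μ * M → (2 : ℤ) ∣ M →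
      ∀ ρ ∈ L, (ρ.2.1 + μ) % 2 = 0 ∧ ρ.2.2 % 8 = (P' + M * (ρ₀.1 - ρ.1)) % 8 := by
    intro M hM hM2 ρ hρ
    obtain ⟨hu, -, R, hrel⟩ := hL ρ hρ
    have hw : w₀ - n ^ 2 * ρ.1 = (2 : ℤ) ^ μ * (P' + M * (ρ₀.1 - ρ.1)) := by
      linear_combination hP + (ρ₀.1 - ρ.1) * hM
    have hunit : ¬ (2 : ℤ) ∣ P' + M * (ρ₀.1 - ρ.1) := by
      intro h
      apply hP'
      have h2 : (2 : ℤ) ∣ M * (ρ₀.1 - ρ.1) := dvd_mul_of_dvd_left hM2 _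
      simpa using dvd_sub h h2
    rw [hw] at hrel
    exact core8 hu hunit μ ρ.2.1 N R hμN hrel
  by_cases hn0 : n = 0
  · -- `n = 0`: every root is diagonal RATIONAL-like, pattern `(μ + 4, P')`
    subst hn0
    have hs := sig 0 (by ring) (dvd_zero _)
    refine ratLike_elim hrat (g := μ + 4) (by omega) hP' ?_
    intro ρ hρ
    obtain ⟨h1, h2⟩ := hs ρ hρ
    refine ⟨by omega, ?_⟩
    rw [h2, zero_mul, add_zero]
    have e1 : P' - (2 : ℤ) ^ (μ + 4) * ρ.1 = P' + 8 * (-(2 * (2 : ℤ) ^ μ * ρ.1)) := by rw [pow_add]; ring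
    rw [e1, Int.add_mul_emod_self_left]
  · obtain ⟨τ, n', hn', hnd⟩ : ∃ (k : ℕ) (x' : ℤ), n = (2 : ℤ) ^ k * x' ∧ ¬ (2 : ℤ) ∣ x' :=
      ⟨_, (Int.finiteMultiplicity_iff.mpr ⟨by decide, hn0⟩).exists_eq_pow_mul_and_not_dvd⟩
    by_cases h2τ : 2 * τ ≤ μ
    · -- the walk with the even offset `2τ`
      obtain ⟨i, hi⟩ : ∃ i, μ = 2 * τ + i := ⟨μ - 2 * τ, by omega⟩
      have hw₀ : w₀ = (2 : ℤ) ^ (2 * τ) * ((2 : ℤ) ^ i * P' + n' ^ 2 * ρ₀.1) := by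
        have e := hP
        rw [hi, pow_add, hn', mul_pow, ← pow_mul] at e
        linear_combination e
      refine kill_of_walk8 (K := 2 * τ) (by omega) (by omega) hwalk (fun ρ hρ => (hL ρ hρ).1)
        (y₀ := (2 : ℤ) ^ i * P' + n' ^ 2 * ρ₀.1) hnd ?_
      intro ρ hρ
      obtain ⟨-, -, R, hrel⟩ := hL ρ hρ
      refine ⟨R, ?_⟩
      have e : w₀ - n ^ 2 * ρ.1 =
          (2 : ℤ) ^ (2 * τ) * ((2 : ℤ) ^ i * P' + n' ^ 2 * ρ₀.1 - n' ^ 2 * ρ.1) := by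
        rw [hw₀, hn', mul_pow, ← pow_mul]; ring
      rwa [e] at hrel
    · -- `v₂(n²) = 2τ > μ`: RATIONAL-like with `g = 2τ − μ ≥ 1`, `Q = P' + 2^g·n'²·e₀`
      push Not at h2τ
      obtain ⟨k, hk⟩ : ∃ k, 2 * τ = μ + k := ⟨2 * τ - μ, by omega⟩
      have hk1 : 1 ≤ k := by omega
      have hM : n ^ 2 = (2 : ℤ) ^ μ * ((2 : ℤ) ^ k * n' ^ 2) := by
        rw [hn', mul_pow, ← pow_mul, show τ * 2 = μ + k by omega, pow_add]; ring
      have hM2 : (2 : ℤ) ∣ (2 : ℤ) ^ k * n' ^ 2 := dvd_mul_of_dvd_left (dvd_pow_self 2 (by omega)) _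
      have hs := sig _ hM hM2
      have hQ : ¬ (2 : ℤ) ∣ P' + (2 : ℤ) ^ k * n' ^ 2 * ρ₀.1 := by
        intro h
        apply hP'
        have h2 : (2 : ℤ) ∣ (2 : ℤ) ^ k * n' ^ 2 * ρ₀.1 := dvd_mul_of_dvd_left hM2 _
        simpa using dvd_sub h h2
      have h81 : (8 : ℤ) ∣ n' ^ 2 - 1 := by have := sq_emod_eight_of_not_two_dvd hnd; omega
      obtain ⟨c8, hc8⟩ := h81
      refine ratLike_elim hrat (g := k) hk1 hQ ?_
      intro ρ hρ
      obtain ⟨h1, h2⟩ := hs ρ hρ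
      refine ⟨by omega, ?_⟩
      rw [h2]
      have e1 : P' + (2 : ℤ) ^ k * n' ^ 2 * ρ₀.1 - (2 : ℤ) ^ k * ρ.1 =
          (P' + (2 : ℤ) ^ k * n' ^ 2 * (ρ₀.1 - ρ.1)) + 8 * ((2 : ℤ) ^ k * ρ.1 * c8) := by
        linear_combination ((2 : ℤ) ^ k * ρ.1) * hc8
      rw [e1, Int.add_mul_emod_self_left]

/-! ### Soundness of the certificate -/

/-- **Soundness of the 2-adic signature kill certificate**: if `sig8Check … N ε₁ ε₂ ε₃ = true`, then `killQ` has no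
integer zero that is primitive at `2` — verbatim the conclusion of `killCheck_sound` at the prime `2`.
[cite: Cassels1991LecturesEllipticCurves, §15] [cite: CremonaAlgorithms1997, §3.6] -/
theorem sig8Check_sound {a b c : ℤ} {z : ℤ × ℤ × ℤ} {t₁ t₂ : ℤ} {N : ℕ}
    {ε₁ ε₂ ε₃ : ℤ} (h : sig8Check a b c z t₁ t₂ N ε₁ ε₂ ε₃ = true) (v : ℤ × ℤ × ℤ × ℤ)
    (hprim : ¬ ((2 : ℤ) ∣ v.1 ∧ (2 : ℤ) ∣ v.2.1 ∧ (2 : ℤ) ∣ v.2.2.1 ∧ (2 : ℤ) ∣ v.2.2.2))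
    (h0 : killQ a b c z t₁ t₂ v = 0) : False := by
  obtain ⟨r₀, r₁, r₂, n⟩ := v
  simp only [sig8Check, Bool.and_eq_true] at h
  obtain ⟨⟨⟨⟨⟨⟨⟨hk₁, hk₂⟩, hk₃⟩, hu₁₂⟩, hu₁₃⟩, hu₂₃⟩, hrat⟩, hwalk⟩ := h
  simp only [rootOK, unitOK, Bool.and_eq_true, Bool.not_eq_true', decide_eq_true_eq,
    decide_eq_false_iff_not] at hk₁ hk₂ hk₃ hu₁₂ hu₁₃ hu₂₃
  have hf₁₂ : ¬ (2 : ℤ) ∣ (splitPow 2 N (ε₁ - ε₂)).2 := fun hd => hu₁₂ (Int.emod_eq_zero_of_dvd hd)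
  have hf₁₃ : ¬ (2 : ℤ) ∣ (splitPow 2 N (ε₁ - ε₃)).2 := fun hd => hu₁₃ (Int.emod_eq_zero_of_dvd hd)
  have hf₂₃ : ¬ (2 : ℤ) ∣ (splitPow 2 N (ε₂ - ε₃)).2 := fun hd => hu₂₃ (Int.emod_eq_zero_of_dvd hd)
  -- the three root relations
  have rel : ∀ ε : ℤ, (ε ^ 3 + a * ε ^ 2 + b * ε + c) % ((2 ^ N : ℕ) : ℤ) = 0 →
      (2 : ℤ) ^ N ∣ (2 : ℤ) ^ (rootData 2 N z t₁ t₂ ε).2.1 * (rootData 2 N z t₁ t₂ ε).2.2 *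
          (r₀ + r₁ * ε + r₂ * ε ^ 2) ^ 2 - ((zsq a b c z (r₀, r₁, r₂)).1 - n ^ 2 * (rootData 2 N z t₁ t₂ ε).1) := by
    intro ε hg
    have h1 := root_rel hg h0
    have h2 := splitPow_spec 2 N ((z.1 + z.2.1 * ε + z.2.2 * ε ^ 2) % ((2 ^ N : ℕ) : ℤ))
    simp only [Nat.cast_ofNat] at h1 h2
    simp only [rootData]
    rw [← h2]
    exact h1
  have rel₁ := rel ε₁ hk₁.1
  have rel₂ := rel ε₂ hk₂.1
  have rel₃ := rel ε₃ hk₃.1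
  -- name the data
  generalize hw₀ : (zsq a b c z (r₀, r₁, r₂)).1 = w₀ at rel₁ rel₂ rel₃
  generalize hD : (splitPow 2 N (ε₁ - ε₂)).1 + (splitPow 2 N (ε₁ - ε₃)).1 + (splitPow 2 N (ε₂ - ε₃)).1 = D
    at hwalk
  generalize hρ₁ : rootData 2 N z t₁ t₂ ε₁ = ρ₁ at hk₁ rel₁ hrat hwalk
  generalize hρ₂ : rootData 2 N z t₁ t₂ ε₂ = ρ₂ at hk₂ rel₂ hrat hwalk
  generalize hρ₃ : rootData 2 N z t₁ t₂ ε₃ = ρ₃ at hk₃ rel₃ hrat hwalk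
  have hu₁ : ¬ (2 : ℤ) ∣ ρ₁.2.2 := fun hd => hk₁.2 (Int.emod_eq_zero_of_dvd hd)
  have hu₂ : ¬ (2 : ℤ) ∣ ρ₂.2.2 := fun hd => hk₂.2 (Int.emod_eq_zero_of_dvd hd)
  have hu₃ : ¬ (2 : ℤ) ∣ ρ₃.2.2 := fun hd => hk₃.2 (Int.emod_eq_zero_of_dvd hd)
  have hLu : ∀ ρ ∈ [ρ₁, ρ₂, ρ₃], ¬ (2 : ℤ) ∣ ρ.2.2 := by
    intro ρ hρ
    simp only [List.mem_cons, List.not_mem_nil, or_false] at hρ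
    rcases hρ with rfl | rfl | rfl
    · exact hu₁
    · exact hu₂
    · exact hu₃
  by_cases hn : (2 : ℤ) ∣ n
  · -- `2 ∣ n`: a root with `2^(D+1) ∤ R` by the index lemma, then `caseB8`
    have hex : ∃ ρ ∈ [ρ₁, ρ₂, ρ₃], ∃ R : ℤ, ¬ (2 : ℤ) ^ (D + 1) ∣ R ∧
        (2 : ℤ) ^ N ∣ (2 : ℤ) ^ ρ.2.1 * ρ.2.2 * R ^ 2 - (w₀ - n ^ 2 * ρ.1) := by
      by_contra hall
      push Not at hall
      have d₁ : (2 : ℤ) ^ (D + 1) ∣ r₀ + r₁ * ε₁ + r₂ * ε₁ ^ 2 := by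
        by_contra hnd; exact hall ρ₁ (by simp) _ hnd rel₁
      have d₂ : (2 : ℤ) ^ (D + 1) ∣ r₀ + r₁ * ε₂ + r₂ * ε₂ ^ 2 := by
        by_contra hnd; exact hall ρ₂ (by simp) _ hnd rel₂
      have d₃ : (2 : ℤ) ^ (D + 1) ∣ r₀ + r₁ * ε₃ + r₂ * ε₃ ^ 2 := by
        by_contra hnd; exact hall ρ₃ (by simp) _ hnd rel₃
      rw [← hD] at d₁ d₂ d₃
      have s₁₂ := splitPow_spec 2 N (ε₁ - ε₂)
      have s₁₃ := splitPow_spec 2 N (ε₁ - ε₃)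
      have s₂₃ := splitPow_spec 2 N (ε₂ - ε₃)
      simp only [Nat.cast_ofNat] at s₁₂ s₁₃ s₂₃
      have hidx := index_lemma Nat.prime_two s₁₂ s₁₃ s₂₃ hf₁₂ hf₁₃ hf₂₃ d₁ d₂ d₃
      simp only [Nat.cast_ofNat] at hidx
      exact hprim ⟨hidx.1, hidx.2.1, hidx.2.2, hn⟩
    obtain ⟨ρ, hρ, R, hR, hrel⟩ := hex
    refine caseB8 hwalk ?_ hrat hρ hR hrel
    intro ρ hρ
    simp only [List.mem_cons, List.not_mem_nil, or_false] at hρ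
    rcases hρ with rfl | rfl | rfl
    · exact ⟨hu₁, le_max_left _ _, _, rel₁⟩
    · exact ⟨hu₂, le_trans (le_max_left _ _) (le_max_right _ _), _, rel₂⟩
    · exact ⟨hu₃, le_trans (le_max_right _ _) (le_max_right _ _), _, rel₃⟩
  · -- `2 ∤ n`: the walk at offset `0` with `y = w₀ / n²`
    refine kill_of_walk8 (K := 0) (Nat.zero_le _) (by rfl) hwalk hLu (y₀ := w₀) hn ?_
    intro ρ hρ
    simp only [List.mem_cons, List.not_mem_nil, or_false] at hρ
    rcases hρ with rfl | rfl | rfl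
    · exact ⟨r₀ + r₁ * ε₁ + r₂ * ε₁ ^ 2, by rw [pow_zero, one_mul]; exact rel₁⟩
    · exact ⟨r₀ + r₁ * ε₂ + r₂ * ε₂ ^ 2, by rw [pow_zero, one_mul]; exact rel₂⟩
    · exact ⟨r₀ + r₁ * ε₃ + r₂ * ε₃ ^ 2, by rw [pow_zero, one_mul]; exact rel₃⟩

/-- **Validity from the 2-adic signature certificate**: `sig8Check` gives `KillValidAt 2`, dropping into
`killListCheckV` / `admKillsV_sound` exactly like `killValidAt_of_sig3Check`. [cite: CremonaAlgorithms1997, §3.6] -/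
theorem killValidAt_of_sig8Check {a b c : ℤ} {z : ℤ × ℤ × ℤ} {t₁ t₂ : ℤ} {N : ℕ}
    {ε₁ ε₂ ε₃ : ℤ} (h : sig8Check a b c z t₁ t₂ N ε₁ ε₂ ε₃ = true) : KillValidAt 2 a b c z t₁ t₂ :=
  fun v hprim h0 => sig8Check_sound h v hprim h0

end Summit.BirchSwinnertonDyer.BirchSwinnertonDyer.Rank2Observatory.TwoDescKill
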